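import Literature.MathematicalPhysics.QuantumLattice.HubbardOpenBoxEDUpperCertificateFast
import HarnessLib

/-!
# Upper certificates: a short-circuiting support test

Topic `MathematicalPhysics/QuantumLattice`, family `hubbard`. `UpperCert.supp₃` tests, for every occupation
code, `(particle number = N) || (coefficient = 0)`; the kernel evaluates the particle number (a loop over all
orbitals) even for the codes outside the vector's support, which are the vast majority. `UpperCert.supp₅`
swaps the disjuncts (`(coefficient = 0) || (particle number = N)`, short-circuiting on the support test);
`supp₅_eq : supp₅ = supp₃` and **`UpperCert.sound₅`** (= `sound₄` with `supp₅`). Nothing numerical.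

## References

* A. Neumaier, Acta Numerica 13 (2004), §11. [cite: Neumaier2004CompleteSearch, §11]
* D. Ruelle, *Statistical Mechanics: Rigorous Results* (1969), §3.3. [cite: Ruelle1969, §3.3]
-/

namespace Literature.MathematicalPhysics.QuantumLattice

namespace OccupationCode

namespace UpperCert

variable (C : UpperCert)

/-- Support test, short-circuit order: `(f m = 0) || (#particles m = N)` over all codes, as `L` nested loops
of length `B`. [cite: Neumaier2004CompleteSearch, §11] -/
def supp₅ (a b N B L : ℕ) : Bool :=
  allNest (fun m => decide (C.fAt m = 0) || decide (upCount (a * b) m + dnCount (a * b) m = N)) B L 0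

/-- `supp₅ = supp₃`. [cite: Neumaier2004CompleteSearch, §11] -/
theorem supp₅_eq (a b N B L : ℕ) : C.supp₅ a b N B L = C.supp₃ a b N B L := by
  unfold supp₅ supp₃
  congr 1
  funext m
  rw [Bool.or_comm]

/-- **SOUNDNESS with the short-circuiting support test**: as `sound₄`. [cite: Ruelle1969, §3.3] -/
theorem sound₅ {a b N B L : ℕ} {EK EP EM ED : ℚ} (hBL : B ^ L = 4 ^ (a * b))
    (hsupp : C.supp₅ a b N B L = true) (hNN : 0 < C.NN₃ B L)
    (hK : (-(C.SHop₄ (nnAdjCode b) a b B L) : ℚ) ≤ EK * C.NN₃ B L)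
    (hP : (-(C.SHop₄ (diagAdjCode b) a b B L) : ℚ) ≤ EP * C.NN₃ B L)
    (hM : ((C.SHop₄ (diagAdjCode b) a b B L) : ℚ) ≤ EM * C.NN₃ B L)
    (hD : ((C.SD₃ a b B L) : ℚ) ≤ ED * C.NN₃ B L)
    (ha : 1 ≤ a) (hb : 1 ≤ b) (hN : N < 2 * (a * b)) (t' : ℝ) {U : ℝ} (hU : 0 ≤ U) :
    ThermodynamicLimit.energyDensityTT' 1 t' U ((N : ℝ) / ((a : ℝ) * (b : ℝ))) ≤
      ((EK : ℝ) + max (t' * EP) (-t' * EM) + U * ED) / ((a : ℝ) * (b : ℝ)) := by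
  rw [supp₅_eq] at hsupp
  exact C.sound₄ hBL hsupp hNN hK hP hM hD ha hb hN t' hU

end UpperCert

end OccupationCode

end Literature.MathematicalPhysics.QuantumLattice
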